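import Mathlib
import Literature.NumberTheory.LFunctions.Zhang2022.Section13ConjugateAFE
import HarnessLib

/-!
# Zhang (2022) §13, the "By Lemma 6.1 and 5.1" step after (13.2): `Z22:§13.u003` as a
# kernel-checked EDGE from Lemma 6.1 and Proposition 2.2 (i)

Topic `Literature/NumberTheory/LFunctions/Zhang2022` (Landau–Siegel audit tree; verdict-neutral).
Y. Zhang, *Discrete mean estimates and the Landau–Siegel zero*, arXiv:2211.02515v1 (2022)
[Zhang2022LandauSiegel], §13 p. 74 (tex L3755–3758), for `ψ ∈ Ψ₁`, `ρ ∈ 𝔷(ψ)`: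

> By Lemma 6.1 and 5.1, `(pt₀)^{β₁}L(1−ρ−β₂,ψ̄) = (pt₀)^{β₁}K(1−ρ−β₂,ψ̄)
> + (pt₀)^{β₃}Z(ρ,ψ)⁻¹N(ρ+β₂,ψ) + O(N(ρ+β₂,ψ)𝓛⁻¹²³) + O(E₁(ρ+β₂,ψ))`

Campaign D-0069 (IUT playbook #2), DAG node `Z22:§13.u003`, typed statement-exact as
`Typed.Section13.U003 c′ c₀` (`TypedSection13.lean`, p411917).

**What is proved** (0 new facts, no Assumption (A) used):
`Typed.Section13.u003_of : Skeleton.Prop22i → Skeleton.Lemma61 → ∀ c′, ∃ c₁ > 0, ∀ c₀ ≤ c₁,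
U003 c′ c₀` — Lemma 6.1 (`Skeleton.Lemma61`, CLAIM leaf; its `ε = exp{−c𝓛¹⁰}` fixes `c₁ = c`)
at `s = ρ+β₂`, CONJUGATED on the critical line (Proposition 2.2 (i), `Skeleton.Prop22i`; the
conjugation lemmas of `Section13ConjugateAFE`), times `(pt₀)^{β₁}` (modulus one), plus the
"Lemma 5.1" step `(pt₀)^{β₁}Z(ρ+β₂,ψ)⁻¹ = (pt₀)^{β₃}Z(ρ,ψ)⁻¹ + O(𝓛⁻¹²³)` from the tree's EXACT
`GammaFactor.Zfac_vertical_shift` (`Z(s+iv) = Z(s)e^{−iv·log(pt/2π)}e^{η}`, `‖η‖ ≤ (2|v|+14)|v|/t`)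
and `β₁ + β₂ = β₃` ((2.13)); the `(pt₀)`-versus-`(pt/2π)` discrepancy is
`≤ |v₂|𝓛₁/(πt₀) ≤ 3(1+5π|c′|)𝓛⁻¹²³` (`α𝓛₁/(πt₀) = 𝓛⁻¹²³` exactly, `9 + 519 − 405 = 123`).

WHAT THIS IS NOT: a proof of Lemma 6.1, Lemma 5.1 or Proposition 2.2 themselves; any claim about
Theorems 1–2 of the manuscript or about Landau–Siegel zeros.

## References

* Y. Zhang, arXiv:2211.02515v1 (2022), §13 p. 74; §6 Lemma 6.1 p. 30; §5 Lemma 5.1 p. 24;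
  §2 (2.2), (2.13), Prop. 2.2 (i). [cite: Zhang2022LandauSiegel, §13 p.74]
-/

noncomputable section

open Complex Real ComplexConjugate

namespace Literature.NumberTheory.LFunctions.Zhang2022.Typed.Section13

open Skeleton GammaFactor

/-! ## Parameter bookkeeping (private copies, as in `Section13ConjugateAFE`) -/

/-- `β₁ = iv₁`, `v₁ = α(1−5c′α𝓛)`. [cite: Zhang2022LandauSiegel, §2 (2.13)] -/
private theorem beta1_eq'' (c' : ℝ) (D : ℕ) :
    beta1 c' D = ((alpha D * (1 - 5 * c' * alpha D * ell D) : ℝ) : ℂ) * I := by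
  simp only [beta1]; push_cast; ring


/-- `β₂ = iv₂`, `v₂ = 2α(1+c′α𝓛)`. [cite: Zhang2022LandauSiegel, §2 (2.13)] -/
private theorem beta2_eq'' (c' : ℝ) (D : ℕ) :
    beta2 c' D = ((2 * alpha D * (1 + c' * alpha D * ell D) : ℝ) : ℂ) * I := by
  simp only [beta2]; push_cast; ring


/-- `β₃ = iv₃`, `v₃ = 3α(1−c′α𝓛)`. [cite: Zhang2022LandauSiegel, §2 (2.13)] -/
private theorem beta3_eq'' (c' : ℝ) (D : ℕ) :
    beta3 c' D = ((3 * alpha D * (1 - c' * alpha D * ell D) : ℝ) : ℂ) * I := by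
  simp only [beta3]; push_cast; ring


/-- `α = π/𝓛⁹` ((2.10), `P = exp 𝓛⁹`). [cite: Zhang2022LandauSiegel, §2 (2.10)] -/
private theorem alpha_eq'' (D : ℕ) : alpha D = π / ell D ^ 9 := by
  rw [alpha, bigP, Real.log_exp]


/-- For `𝓛 ≥ 1`: `0 < α`, `α𝓛 ≤ π` and `α ≤ π/𝓛`. [cite: Zhang2022LandauSiegel, §2 (2.10)] -/
private theorem alpha_bounds'' {D : ℕ} (hℓ : 1 ≤ ell D) :
    0 < alpha D ∧ 0 ≤ alpha D * ell D ∧ alpha D * ell D ≤ π ∧ alpha D ≤ π / ell D := by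
  have hℓ0 : 0 < ell D := by linarith
  have h9 : 1 ≤ ell D ^ 9 := one_le_pow₀ hℓ
  have hα : alpha D = π / ell D ^ 9 := alpha_eq'' D
  have hαpos : 0 < alpha D := by rw [hα]; positivity
  have h8 : ell D ≤ ell D ^ 9 := by
    calc ell D = ell D ^ 1 := (pow_one _).symm
      _ ≤ ell D ^ 9 := pow_le_pow_right₀ hℓ (by norm_num)
  have hαℓ : alpha D * ell D ≤ π := by
    calc alpha D * ell D ≤ alpha D * ell D ^ 9 := by gcongr
      _ = π := by rw [hα, div_mul_cancel₀ _ (by positivity)]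
  refine ⟨hαpos, by positivity, hαℓ, ?_⟩
  rw [le_div_iff₀ hℓ0]; exact hαℓ


/-- `|v₂| ≤ 3αK`, `K = 1 + 5π|c′|` (`𝓛 ≥ 1`). [cite: Zhang2022LandauSiegel, §2 (2.13)] -/
private theorem abs_v2_le {c' : ℝ} {D : ℕ} (hℓ : 1 ≤ ell D) :
    |2 * alpha D * (1 + c' * alpha D * ell D)| ≤ 3 * alpha D * (1 + 5 * π * |c'|) := by
  obtain ⟨hαpos, hαℓ0, hαℓ, -⟩ := alpha_bounds'' hℓ
  have hc : 0 ≤ |c'| := abs_nonneg _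
  have hπ : 0 ≤ π := pi_pos.le
  have hb : |c' * alpha D * ell D| ≤ π * |c'| := by
    rw [show c' * alpha D * ell D = c' * (alpha D * ell D) by ring, abs_mul, abs_of_nonneg hαℓ0]
    calc |c'| * (alpha D * ell D) ≤ |c'| * π := by gcongr
      _ = π * |c'| := by ring
  have h1 : |1 + c' * alpha D * ell D| ≤ 1 + π * |c'| := by
    calc |1 + c' * alpha D * ell D| ≤ |(1 : ℝ)| + |c' * alpha D * ell D| := abs_add_le _ _
      _ ≤ 1 + π * |c'| := by rw [abs_one]; linarith
  rw [abs_mul, abs_of_nonneg (by positivity : 0 ≤ 2 * alpha D)]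
  calc 2 * alpha D * |1 + c' * alpha D * ell D| ≤ 2 * alpha D * (1 + π * |c'|) := by gcongr
    _ ≤ 3 * alpha D * (1 + 5 * π * |c'|) := by nlinarith [mul_nonneg hπ hc, hαpos]
/-- `|log u| ≤ 2|u − 1|` for `|u − 1| ≤ 1/2`. [folklore] -/
private theorem abs_log_le_two_mul' {u : ℝ} (hu : |u - 1| ≤ 1 / 2) : |Real.log u| ≤ 2 * |u - 1| := by
  have hu1 := (abs_le.mp hu).1
  have hupos : 0 < u := by linarith
  have hup : Real.log u ≤ u - 1 := Real.log_le_sub_one_of_pos hupos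
  have hlow : 1 - u⁻¹ ≤ Real.log u := Real.one_sub_inv_le_log_of_pos hupos
  rw [abs_le]
  constructor
  · have h2 : -(2 * |u - 1|) ≤ 1 - u⁻¹ := by
      have : 1 - u⁻¹ = (u - 1) / u := by field_simp
      rw [this, le_div_iff₀ hupos]
      have := neg_abs_le (u - 1)
      nlinarith [abs_nonneg (u - 1)]
    linarith
  · linarith [le_abs_self (u - 1), abs_nonneg (u - 1)]


/-- The exponent of record: `α𝓛₁/(πt₀) = 𝓛⁻¹²³`. [cite: Zhang2022LandauSiegel, §5 Lemma 5.1] -/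
private theorem alpha_ell1_div' {D : ℕ} (hℓ : (0 : ℝ) < ell D) :
    alpha D * ell1 D / (π * t0 D) = (ell D ^ 123)⁻¹ := by
  rw [alpha_eq'', ell1, t0]
  have hπ : (π : ℝ) ≠ 0 := pi_pos.ne'
  have hℓ0 : ell D ≠ 0 := hℓ.ne'
  field_simp


/-- For `D ≥ ⌈exp M⌉` with `M ≥ 4`: `4 ≤ M ≤ 𝓛 ≤ t₀`, `𝓛₁ ≤ t₀`, `𝓛 > 0`.
[cite: Zhang2022LandauSiegel, §2 (2.8)] -/
private theorem largeD {M : ℝ} {D : ℕ} (hM4 : 4 ≤ M) (hD : ⌈Real.exp M⌉₊ ≤ D) :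
    M ≤ ell D ∧ 1 ≤ ell D ∧ ell D ≤ t0 D ∧ ell1 D ≤ t0 D ∧ 0 < t0 D := by
  have hDreal : Real.exp M ≤ (D : ℝ) := le_trans (Nat.le_ceil _) (by exact_mod_cast hD)
  have hDpos : (0 : ℝ) < D := lt_of_lt_of_le (Real.exp_pos M) hDreal
  have hℓM : M ≤ ell D := by rw [ell]; exact (Real.le_log_iff_exp_le hDpos).mpr hDreal
  have hℓ1 : 1 ≤ ell D := by linarith
  have ht0ℓ : ell D ≤ t0 D := by rw [t0]; exact le_self_pow₀ hℓ1 (by norm_num)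
  have hℓ1t0 : ell1 D ≤ t0 D := by rw [ell1, t0]; exact pow_le_pow_right₀ hℓ1 (by norm_num)
  exact ⟨hℓM, hℓ1, ht0ℓ, hℓ1t0, by linarith⟩


/-- A zero `ρ ∈ 𝔷(ψ)` has `t₀ ≤ Im ρ` (once `𝓛₁ ≤ t₀`, `t₀ ≥ 0`).
[cite: Zhang2022LandauSiegel, §2 (2.14)] -/
private theorem t0_le_im {D : ℕ} {x : Chr D} {ρ : ℂ} (hρ : ρ ∈ zeroSet D x)
    (hℓ1t0 : ell1 D ≤ t0 D) (ht0 : 0 < t0 D) : t0 D ≤ ρ.im := by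
  obtain ⟨-, him, -⟩ := hρ
  have h1 := (abs_lt.mp him).1
  have hπ : (3 : ℝ) < π := Real.pi_gt_three
  nlinarith


/-- On the critical line `1 − s = s̄`. [cite: Zhang2022LandauSiegel, §13 p.74] -/
private theorem one_sub_eq_conj {s : ℂ} (hs : s.re = 1 / 2) : 1 - s = conj s := by
  apply Complex.ext
  · simp [hs]; norm_num
  · simp


/-! ## `Z22:§13.u003` -/

/-- **`Z22:§13.u003` as a kernel-checked EDGE** [Z22 p.74, display after (13.2), tex L3755–3758]:
Proposition 2.2 (i) and Lemma 6.1 imply `U003 c′ c₀` for every `c′` and every `c₀ ≤ c₁` (`c₁ > 0`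
the constant of Lemma 6.1's `ε`): for `D` large, `ψ ∈ Ψ₁`, `ρ ∈ 𝔷(ψ)`,
`‖(pt₀)^{β₁}L(1−ρ−β₂,ψ̄) − (pt₀)^{β₁}K(1−ρ−β₂,ψ̄) − (pt₀)^{β₃}Z(ρ,ψ)⁻¹N(ρ+β₂,ψ)‖`
`≤ C(|N(ρ+β₂,ψ)|𝓛⁻¹²³ + E₁(ρ+β₂,ψ))`, `C = max(C₆₁, 32 + 6(1+5π|c′|))`. "Lemma 5.1" is the tree's
exact `GammaFactor.Zfac_vertical_shift`; `β₁ + β₂ = β₃` exactly.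
[cite: Zhang2022LandauSiegel, §13 p.74] -/
theorem u003_of (h22 : Prop22i) (h61 : Lemma61) (c' : ℝ) :
    ∃ c₁ : ℝ, 0 < c₁ ∧ ∀ c₀ : ℝ, c₀ ≤ c₁ → U003 c' c₀ := by
  obtain ⟨c, hc, C₁, D₆, h61⟩ := h61
  obtain ⟨D₂, h22⟩ := h22
  refine ⟨c, hc, fun c₀ hc₀ => ?_⟩
  set K : ℝ := 1 + 5 * π * |c'| with hK
  have hK1 : 1 ≤ K := by rw [hK]; nlinarith [pi_pos, abs_nonneg c']
  set M : ℝ := 16 + 3 * π * K with hM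
  have hM4 : 4 ≤ M := by rw [hM]; nlinarith [pi_pos]
  refine ⟨max (max C₁ 0) (32 + 6 * K), max (max D₆ D₂) ⌈Real.exp M⌉₊,
    fun D _ χ hD hq hp _ x hx ρ hρ => ?_⟩
  have hD₆ : D₆ ≤ D := le_trans (le_trans (le_max_left _ _) (le_max_left _ _)) hD
  have hD₂ : D₂ ≤ D := le_trans (le_trans (le_max_right _ _) (le_max_left _ _)) hD
  have hDM : ⌈Real.exp M⌉₊ ≤ D := le_trans (le_max_right _ _) hD
  obtain ⟨hℓM, hℓ1, ht0ℓ, hℓ1t0, ht0pos⟩ := largeD hM4 hDM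
  have hℓpos : 0 < ell D := by linarith
  have hℓ16 : 16 ≤ ell D := by
    have : 16 ≤ M := by rw [hM]; nlinarith [pi_pos]
    linarith
  -- the zero and the point `s = ρ + β₂`
  have hre : ρ.re = 1 / 2 := h22 D χ hD₂ hq hp x hx ρ (mem_prodZeroSetOmega_of_mem_zeroSet χ hρ)
  have htt0 : t0 D ≤ ρ.im := t0_le_im hρ hℓ1t0 ht0pos
  obtain ⟨-, him, -⟩ := hρ
  set t : ℝ := ρ.im with ht
  have htpos : 0 < t := lt_of_lt_of_le ht0pos htt0
  have ht4 : 4 * (1 : ℝ) ≤ t := by linarith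
  have hρeq : ρ = ((1 / 2 : ℝ) : ℂ) + t * I := by
    rw [← hre]; exact (Complex.re_add_im ρ).symm
  have hav2 := abs_v2_le (c' := c') hℓ1
  obtain ⟨hαpos, -, -, hαπℓ⟩ := alpha_bounds'' hℓ1
  set v1 : ℝ := alpha D * (1 - 5 * c' * alpha D * ell D) with hv1
  set v2 : ℝ := 2 * alpha D * (1 + c' * alpha D * ell D) with hv2
  set v3 : ℝ := 3 * alpha D * (1 - c' * alpha D * ell D) with hv3
  have hsum : v1 + v2 = v3 := by rw [hv1, hv2, hv3]; ring
  have h3αK : 3 * alpha D * K ≤ 1 := by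
    calc 3 * alpha D * K ≤ 3 * (π / ell D) * K := by gcongr
      _ = (3 * π * K) / ell D := by ring
      _ ≤ 1 := by rw [div_le_one hℓpos]; linarith
  have hv2small : |v2| ≤ 1 := le_trans hav2 h3αK
  have hvt2 : |v2| ≤ t / 2 := by linarith
  set s : ℂ := ρ + beta2 c' D with hs
  have hs' : s = ((1 / 2 : ℝ) : ℂ) + t * I + (v2 : ℂ) * I := by rw [hs, beta2_eq'', hρeq]
  have hsre : s.re = 1 / 2 := by rw [hs']; simp
  have hsim : s.im = t + v2 := by rw [hs']; simp
  have hsim_pos : 0 < s.im := by rw [hsim]; have := (abs_le.mp hv2small).1; linarith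
  have hsrange1 : |s.re - 1 / 2| < 2 * alpha D := by rw [hsre, sub_self, abs_zero]; linarith
  have hsrange2 : |s.im - 2 * π * t0 D| < ell1 D + 2 := by
    rw [hsim]
    calc |t + v2 - 2 * π * t0 D| = |(t - 2 * π * t0 D) + v2| := by ring_nf
      _ ≤ |t - 2 * π * t0 D| + |v2| := abs_add_le _ _
      _ < ell1 D + 2 := by linarith
  -- Lemma 6.1 at `s`, conjugated: the remainder `R`
  have h61s := h61 D χ hD₆ hq hp x s hsrange1 hsrange2
  have hconj : 1 - ρ - beta2 c' D = conj s := by rw [hs, ← one_sub_eq_conj hsre]; ring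
  set R : ℂ := x.ψ⁻¹.LFunction (conj s) - Kchar D (psiBarFn x) (conj s) -
    (Zfac x.ψ s)⁻¹ * Nchar D (psiFn x) s with hR
  have hRle : ‖R‖ ≤ max C₁ 0 * E1full c₀ x s := by
    rw [hR, norm_afe_conj_eq x hsre hsim_pos]
    have hE : E1main x s + Real.exp (-c * ell D ^ 10) ≤ E1full c₀ x s := by
      rw [E1full]
      have : Real.exp (-c * ell D ^ 10) ≤ Real.exp (-c₀ * ell D ^ 10) := by
        apply Real.exp_le_exp.mpr
        have : 0 ≤ ell D ^ 10 := by positivity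
        nlinarith
      linarith
    have hE0 : 0 ≤ E1main x s + Real.exp (-c * ell D ^ 10) :=
      add_nonneg (E1main_nonneg x s) (Real.exp_nonneg _)
    calc _ ≤ C₁ * (E1main x s + Real.exp (-c * ell D ^ 10)) := h61s
      _ ≤ max C₁ 0 * (E1main x s + Real.exp (-c * ell D ^ 10)) :=
          mul_le_mul_of_nonneg_right (le_max_left _ _) hE0
      _ ≤ max C₁ 0 * E1full c₀ x s := mul_le_mul_of_nonneg_left hE (le_max_right _ _)
  -- the factors `(pt₀)^{β₁}`, `(pt₀)^{β₃}`
  have hb : 0 < (x.p : ℝ) * t0 D := mul_pos (Nat.cast_pos.mpr x.prime.pos) ht0pos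
  set L₀ : ℝ := Real.log ((x.p : ℝ) * t0 D) with hL₀
  have hpow1 : ((((x.p : ℝ) * t0 D : ℝ)) : ℂ) ^ beta1 c' D = cexp (((v1 * L₀ : ℝ)) * I) := by
    rw [Complex.cpow_def_of_ne_zero (by exact_mod_cast hb.ne'), ← Complex.ofReal_log hb.le,
      beta1_eq'']
    congr 1
    rw [hv1, hL₀]; push_cast; ring
  have hpow3 : ((((x.p : ℝ) * t0 D : ℝ)) : ℂ) ^ beta3 c' D =
      cexp (((v1 * L₀ : ℝ)) * I) * cexp (((v2 * L₀ : ℝ)) * I) := by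
    rw [Complex.cpow_def_of_ne_zero (by exact_mod_cast hb.ne'), ← Complex.ofReal_log hb.le,
      beta3_eq'', ← Complex.exp_add]
    congr 1
    rw [hL₀, hv1, hv2]; push_cast; ring
  have hB1norm : ‖cexp (((v1 * L₀ : ℝ)) * I)‖ = 1 := Complex.norm_exp_ofReal_mul_I _
  -- the vertical shift at `v₂`
  obtain ⟨η₂, hη₂, hZ2⟩ := Zfac_vertical_shift x.prim le_rfl (by norm_num : (0 : ℝ) < 1 / 2)
    (by norm_num : (1 / 2 : ℝ) ≤ 1) ht4 hvt2
  set L : ℂ := ((Real.log ((x.p : ℝ) * t / (2 * π)) : ℝ) : ℂ) with hL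
  set Z0 : ℂ := Zfac x.ψ (((1 / 2 : ℝ) : ℂ) + t * I) with hZ0
  have hZ0ρ : Zfac x.ψ ρ = Z0 := by rw [hZ0, hρeq]
  have hZ0norm : ‖Z0‖ = 1 := by
    rw [hZ0]
    have : ((1 / 2 : ℝ) : ℂ) + t * I = 1 / 2 + t * I := by push_cast; ring
    rw [this]; exact norm_Zfac_half_eq_one x.prim htpos
  have hZ0ne : Z0 ≠ 0 := by
    intro h; rw [h, norm_zero] at hZ0norm; exact zero_ne_one hZ0norm
  have hZs : Zfac x.ψ s = Z0 * cexp (-((v2 : ℂ) * L) * I) * cexp η₂ := by rw [hs']; exact hZ2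
  have hinv2 : (Zfac x.ψ s)⁻¹ = Z0⁻¹ * cexp ((v2 : ℂ) * L * I) * cexp (-η₂) := by
    rw [hZs]
    apply inv_eq_of_mul_eq_one_right
    have hc1 : cexp (-((v2 : ℂ) * L) * I) * cexp ((v2 : ℂ) * L * I) = 1 := by
      rw [← Complex.exp_add, show -((v2 : ℂ) * L) * I + (v2 : ℂ) * L * I = 0 by ring,
        Complex.exp_zero]
    calc Z0 * cexp (-((v2 : ℂ) * L) * I) * cexp η₂ * (Z0⁻¹ * cexp ((v2 : ℂ) * L * I) * cexp (-η₂))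
        = (Z0 * Z0⁻¹) * (cexp (-((v2 : ℂ) * L) * I) * cexp ((v2 : ℂ) * L * I)) *
            (cexp η₂ * cexp (-η₂)) := by ring
      _ = 1 := by
          rw [mul_inv_cancel₀ hZ0ne, hc1, ← Complex.exp_add, add_neg_cancel, Complex.exp_zero]; ring
  -- the discrepancy `Δ = (pt₀)^{β₁}Z(s)⁻¹ − (pt₀)^{β₃}Z(ρ)⁻¹`
  set θ : ℝ := v2 * (L₀ - Real.log ((x.p : ℝ) * t / (2 * π))) with hθ
  have hsplit : cexp (((v2 * L₀ : ℝ)) * I) = cexp ((v2 : ℂ) * L * I) * cexp ((θ : ℂ) * I) := by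
    rw [← Complex.exp_add]; congr 1; rw [hθ, hL]; push_cast; ring
  have hΔ : cexp (((v1 * L₀ : ℝ)) * I) * (Zfac x.ψ s)⁻¹ -
      cexp (((v1 * L₀ : ℝ)) * I) * cexp (((v2 * L₀ : ℝ)) * I) * Z0⁻¹ =
      cexp (((v1 * L₀ : ℝ)) * I) * Z0⁻¹ * cexp ((v2 : ℂ) * L * I) *
        (cexp (-η₂) - cexp ((θ : ℂ) * I)) := by
    rw [hinv2, hsplit]; ring
  -- `|θ| ≤ 3K 𝓛⁻¹²³`
  have hθ_le : |θ| ≤ 3 * K * (ell D ^ 123)⁻¹ := by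
    have hp0 : (0 : ℝ) < x.p := Nat.cast_pos.mpr x.prime.pos
    have h2π : (0 : ℝ) < 2 * π := mul_pos two_pos pi_pos
    have h2πt0 : (0 : ℝ) < 2 * π * t0 D := mul_pos h2π ht0pos
    set u : ℝ := t / (2 * π * t0 D) with hu
    have hupos : 0 < u := div_pos htpos h2πt0
    have hlog : L₀ - Real.log ((x.p : ℝ) * t / (2 * π)) = -Real.log u := by
      rw [hL₀, hu, Real.log_div (mul_pos hp0 htpos).ne' h2π.ne', Real.log_mul hp0.ne' ht0pos.ne',
        Real.log_mul hp0.ne' htpos.ne', Real.log_div htpos.ne' h2πt0.ne',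
        Real.log_mul h2π.ne' ht0pos.ne']
      ring
    have hu1 : |u - 1| ≤ ell1 D / (2 * π * t0 D) := by
      have hne : 2 * π * t0 D ≠ 0 := h2πt0.ne'
      have : u - 1 = (t - 2 * π * t0 D) / (2 * π * t0 D) := by rw [hu]; field_simp
      rw [this, abs_div, abs_of_pos h2πt0]
      exact div_le_div_of_nonneg_right him.le h2πt0.le
    have hu_half : |u - 1| ≤ 1 / 2 := by
      refine le_trans hu1 ?_
      rw [div_le_iff₀ h2πt0]
      have hπ3 : (3 : ℝ) < π := Real.pi_gt_three
      have h1 : t0 D ≤ π * t0 D := le_mul_of_one_le_left ht0pos.le (by linarith only [hπ3])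
      linarith only [hℓ1t0, h1]
    have hlogu : |Real.log u| ≤ 2 * (ell1 D / (2 * π * t0 D)) :=
      le_trans (abs_log_le_two_mul' hu_half) (mul_le_mul_of_nonneg_left hu1 zero_le_two)
    have hπ0 : (π : ℝ) ≠ 0 := pi_pos.ne'
    have ht00 : t0 D ≠ 0 := ht0pos.ne'
    have halg : (3 * alpha D * K) * (2 * (ell1 D / (2 * π * t0 D))) =
        3 * K * (alpha D * ell1 D / (π * t0 D)) := by
      field_simp
    calc |θ| = |v2| * |Real.log u| := by rw [hθ, hlog, abs_mul, abs_neg]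
      _ ≤ (3 * alpha D * K) * (2 * (ell1 D / (2 * π * t0 D))) :=
          mul_le_mul hav2 hlogu (abs_nonneg _) (by nlinarith only [hαpos, hK1])
      _ = 3 * K * (alpha D * ell1 D / (π * t0 D)) := halg
      _ = 3 * K * (ell D ^ 123)⁻¹ := by rw [alpha_ell1_div' hℓpos]
  have h123ℓ : ell D ≤ ell D ^ 123 := le_self_pow₀ hℓ1 (by norm_num)
  have hinv0 : 0 ≤ (ell D ^ 123)⁻¹ := inv_nonneg.mpr (pow_nonneg hℓpos.le _)
  have hθ1 : ‖((θ : ℂ)) * I‖ ≤ 1 := by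
    rw [norm_mul, Complex.norm_I, mul_one, Complex.norm_real, Real.norm_eq_abs]
    refine le_trans hθ_le ?_
    rw [← div_eq_mul_inv, div_le_one (pow_pos hℓpos 123)]
    have : 3 * K ≤ M := by rw [hM]; nlinarith only [hK1, Real.pi_gt_three]
    linarith only [this, hℓM, h123ℓ]
  -- `‖η₂‖ ≤ 16/t ≤ 16 𝓛⁻¹²³ ≤ 1`
  have hη₂' : ‖η₂‖ ≤ 16 / t := by
    refine le_trans hη₂ (div_le_div_of_nonneg_right ?_ htpos.le)
    have h0 : 0 ≤ |v2| := abs_nonneg _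
    nlinarith only [h0, hv2small]
  have h16 : 16 / t ≤ 16 * (ell D ^ 123)⁻¹ := by
    have h1 : ell D ^ 123 ≤ t0 D := by rw [t0]; exact pow_le_pow_right₀ hℓ1 (by norm_num)
    calc 16 / t ≤ 16 / ell D ^ 123 :=
          div_le_div_of_nonneg_left (by norm_num) (pow_pos hℓpos 123) (h1.trans htt0)
      _ = 16 * (ell D ^ 123)⁻¹ := div_eq_mul_inv _ _
  have hη₂1 : ‖η₂‖ ≤ 1 := by
    refine le_trans hη₂' ?_
    rw [div_le_one htpos]; linarith only [hℓ16, ht0ℓ, htt0]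
  have hA : ‖cexp (-η₂) - 1‖ ≤ 2 * (16 / t) := by
    calc ‖cexp (-η₂) - 1‖ ≤ 2 * ‖-η₂‖ := Complex.norm_exp_sub_one_le (by rw [norm_neg]; exact hη₂1)
      _ ≤ 2 * (16 / t) := by rw [norm_neg]; exact mul_le_mul_of_nonneg_left hη₂' zero_le_two
  have hC : ‖cexp ((θ : ℂ) * I) - 1‖ ≤ 2 * (3 * K * (ell D ^ 123)⁻¹) := by
    calc ‖cexp ((θ : ℂ) * I) - 1‖ ≤ 2 * ‖(θ : ℂ) * I‖ := Complex.norm_exp_sub_one_le hθ1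
      _ ≤ 2 * (3 * K * (ell D ^ 123)⁻¹) := by
          rw [norm_mul, Complex.norm_I, mul_one, Complex.norm_real, Real.norm_eq_abs]
          exact mul_le_mul_of_nonneg_left hθ_le zero_le_two
  have hv2L : ‖cexp ((v2 : ℂ) * L * I)‖ = 1 := by
    have : (v2 : ℂ) * L * I = ((v2 * Real.log ((x.p : ℝ) * t / (2 * π)) : ℝ) : ℂ) * I := by
      rw [hL]; push_cast; ring
    rw [this]; exact Complex.norm_exp_ofReal_mul_I _
  have hΔnorm : ‖cexp (((v1 * L₀ : ℝ)) * I) * (Zfac x.ψ s)⁻¹ -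
      cexp (((v1 * L₀ : ℝ)) * I) * cexp (((v2 * L₀ : ℝ)) * I) * Z0⁻¹‖ ≤ (32 + 6 * K) * (ell D ^ 123)⁻¹ := by
    rw [hΔ, norm_mul, norm_mul, norm_mul, hB1norm, norm_inv, hZ0norm, hv2L, inv_one, one_mul,
      one_mul, one_mul]
    calc ‖cexp (-η₂) - cexp ((θ : ℂ) * I)‖ = ‖(cexp (-η₂) - 1) - (cexp ((θ : ℂ) * I) - 1)‖ := by ring_nf
      _ ≤ ‖cexp (-η₂) - 1‖ + ‖cexp ((θ : ℂ) * I) - 1‖ := norm_sub_le _ _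
      _ ≤ 2 * (16 / t) + 2 * (3 * K * (ell D ^ 123)⁻¹) := add_le_add hA hC
      _ ≤ 2 * (16 * (ell D ^ 123)⁻¹) + 2 * (3 * K * (ell D ^ 123)⁻¹) := by linarith only [h16]
      _ = (32 + 6 * K) * (ell D ^ 123)⁻¹ := by ring
  -- assemble
  have hE : (((x.p : ℝ) * t0 D : ℝ) : ℂ) ^ beta1 c' D * x.ψ⁻¹.LFunction (1 - ρ - beta2 c' D) -
      ((((x.p : ℝ) * t0 D : ℝ) : ℂ) ^ beta1 c' D * Kchar D (psiBarFn x) (1 - ρ - beta2 c' D) +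
        (((x.p : ℝ) * t0 D : ℝ) : ℂ) ^ beta3 c' D * (Zfac x.ψ ρ)⁻¹ * Nchar D (psiFn x) (ρ + beta2 c' D)) =
      cexp (((v1 * L₀ : ℝ)) * I) * R +
        (cexp (((v1 * L₀ : ℝ)) * I) * (Zfac x.ψ s)⁻¹ -
          cexp (((v1 * L₀ : ℝ)) * I) * cexp (((v2 * L₀ : ℝ)) * I) * Z0⁻¹) * Nchar D (psiFn x) s := by
    rw [hpow1, hpow3, hconj, hZ0ρ, hR, ← hs]; ring
  rw [hE]
  have hN0 : 0 ≤ ‖Nchar D (psiFn x) s‖ := norm_nonneg _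
  have hEf0 : 0 ≤ E1full c₀ x s := add_nonneg (E1main_nonneg x s) (Real.exp_nonneg _)
  calc ‖cexp (((v1 * L₀ : ℝ)) * I) * R +
        (cexp (((v1 * L₀ : ℝ)) * I) * (Zfac x.ψ s)⁻¹ -
          cexp (((v1 * L₀ : ℝ)) * I) * cexp (((v2 * L₀ : ℝ)) * I) * Z0⁻¹) * Nchar D (psiFn x) s‖
      ≤ ‖cexp (((v1 * L₀ : ℝ)) * I) * R‖ +
        ‖(cexp (((v1 * L₀ : ℝ)) * I) * (Zfac x.ψ s)⁻¹ -
          cexp (((v1 * L₀ : ℝ)) * I) * cexp (((v2 * L₀ : ℝ)) * I) * Z0⁻¹) * Nchar D (psiFn x) s‖ :=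
        norm_add_le _ _
    _ = ‖R‖ + ‖cexp (((v1 * L₀ : ℝ)) * I) * (Zfac x.ψ s)⁻¹ -
          cexp (((v1 * L₀ : ℝ)) * I) * cexp (((v2 * L₀ : ℝ)) * I) * Z0⁻¹‖ * ‖Nchar D (psiFn x) s‖ := by
        rw [norm_mul, hB1norm, one_mul, norm_mul]
    _ ≤ max C₁ 0 * E1full c₀ x s + (32 + 6 * K) * (ell D ^ 123)⁻¹ * ‖Nchar D (psiFn x) s‖ := by
        gcongr
    _ ≤ max (max C₁ 0) (32 + 6 * K) * E1full c₀ x s +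
        max (max C₁ 0) (32 + 6 * K) * (ell D ^ 123)⁻¹ * ‖Nchar D (psiFn x) s‖ :=
        add_le_add (mul_le_mul_of_nonneg_right (le_max_left _ _) hEf0)
          (mul_le_mul_of_nonneg_right (mul_le_mul_of_nonneg_right (le_max_right _ _) hinv0) hN0)
    _ = max (max C₁ 0) (32 + 6 * K) *
        (‖Nchar D (psiFn x) s‖ * (ell D ^ 123)⁻¹ + E1full c₀ x s) := by ring

end Literature.NumberTheory.LFunctions.Zhang2022.Typed.Section13
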